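import Summits.ValiantsHypothesis.ValiantsHypothesis.Theorems.BarrierLeverChowBenchmarkPairsSplitCertEntry
import Literature.Computability.Complexity.BlockTuples
import Summits.ValiantsHypothesis.ValiantsHypothesis.Theorems.BarrierLeverChowBenchmarkPairsPureSplittable
import Summits.ValiantsHypothesis.ValiantsHypothesis.Theorems.BarrierLeverChowBenchmarkPairsSplitLeading
import Summits.ValiantsHypothesis.ValiantsHypothesis.Theorems.BarrierLeverPartitionMinorsMooreBench

/-!
# Route BarrierLever — item 22038 `ChowBenchmarkPairs`, line `moore-peel`: SPLIT CERTIFICATES — part 3: SOUNDNESS OF THE CHECKER,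
# the root instance of a row family on the first `n` codes, and the arrow «certificate ⇒ HAAR instance»

Helper file (`--supports stmt-ValiantsHypothesis-22038`; cell valiant-natproofs, rung V4; seat val-np-p4 gen 24).  Closes NO item.

**SOUNDNESS** (`det_genTable_ne_zero_of_check`, `exists_table_of_check`): if `check k n ls I = true` (and the supports are well formed,
`supOK`), the matrix of `I` at the GENERIC table (`…PureSplittable.genT`, an `MvPolynomial` ring) has nonzero determinant, hence some
complex table makes it nonsingular.  Induction on the levels: a `perm` level permutes columns (`Matrix.det_permute'`); a `split` level is
the heart (`splitStep_sound`): the matrix is BLOCK DIAGONAL by the component labels, each block is specialised by ITS OWN height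
homomorphism `φc` (`X_{(a,c)} ↦ X^{ρ_ℓ(a)}`) — this is how components are certified independently with different vertex orders —, the
specialised matrix satisfies the two-sided scaling identity of `…SplitLeading.det_ne_zero_of_potentials` with leading matrix = the matrix
of the leading instance (entrywise: `…SplitCertEntry.entry_scale` / `entry_eval_zero`), and `Matrix.BlockTriangular.det` passes between
the whole determinant and the blocks (a product of nonzero polynomials is nonzero); the leaf is a diagonal matrix of nonzero naturals.

**ROOT** (`rootInst_matrix`, `exists_table_of_check_root`): the root instance of a row family on the first `n ≤ 2^k` codes has the
weight-one matrix `[dirE P (S i) 1 (bits j)] = [segE P (S i) (benchCols h n j)]`; `haar_of_check`: a certificate for (the encoding of) a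
family `S : Fin n → Finset (Fin h)` of sets of size ≤ 2 gives the conclusion of CONJECTURE HAAR (`…ChowBenchmarkPairsHaar.Stmt.haar`) for
that family, verbatim — so every kernel-checked certificate (`decide +kernel` on `check`) is a HAAR instance in the kernel.  The typed ∀h
node and the per-height instances live in `…SplitCertHomog` (the HOMOGENEOUS root: origin as a generic point, the form in which the
seat's generator — like val-np-p4 g23's — finds top-only triangular certificates at every height tried).

WHAT THIS IS NOT: no stub of the line is closed; nothing on crux stmt-ValiantsHypothesis-14610 or on `VP` versus `VNP`.
-/

set_option linter.dupNamespace false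
set_option autoImplicit false

namespace Summit.ValiantsHypothesis.ValiantsHypothesis.Theorems.BarrierLever.ChowBenchmarkSplit

open Finset Polynomial
open Literature.Computability.Complexity (getD_ofFn)

namespace Cert

variable {p k n : ℕ}

/-! ## 6. Soundness -/

section Sound

/-- The generic table over `MvPolynomial (Fin p × Fin k) ℂ`. -/
noncomputable abbrev G (p k : ℕ) : Fin p → Fin k → MvPolynomial (Fin p × Fin k) ℂ := genT

/-- **Soundness of a permutation level.** -/
theorem permStep_sound (σ : List ℕ) (I : Inst) (hok : (permStep n σ I).1 = true)
    (hdet : ((permStep n σ I).2.matrix p k n (G p k)).det ≠ 0) : (I.matrix p k n (G p k)).det ≠ 0 := by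
  classical
  obtain ⟨hlt, hinj⟩ := permStep_ok σ I hok
  let g : Fin n → Fin n := fun j => ⟨σ.getD j 0, hlt j⟩
  have hg : Function.Injective g := fun j j' e => hinj (by simpa [g] using congrArg Fin.val e)
  let eσ : Equiv.Perm (Fin n) := Equiv.ofBijective g (Finite.injective_iff_bijective.mp hg)
  have hM : (permStep n σ I).2.matrix p k n (G p k) = (I.matrix p k n (G p k)).submatrix id eσ := by
    refine Matrix.ext fun i j => ?_
    rw [Matrix.submatrix_apply, Inst.matrix, Inst.matrix, Matrix.of_apply, Matrix.of_apply, permStep_entL, permStep_colN]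
    rfl
  rw [hM, Matrix.det_permute'] at hdet
  intro h0
  exact hdet (by rw [h0, mul_zero])

/-- **Soundness of the leaf check**: the matrix is diagonal with nonzero natural-number diagonal. -/
theorem leaf_sound (I : Inst) (hok : leafOK n I = true) : (I.matrix p k n (G p k)).det ≠ 0 := by
  classical
  simp only [leafOK, List.all_eq_true, List.mem_range, Bool.and_eq_true, decide_eq_true_eq, Bool.not_eq_true',
    decide_eq_false_iff_not, Bool.or_eq_true] at hok
  have hM : I.matrix p k n (G p k) = Matrix.diagonal fun i : Fin n => (((I.entL i i).1 : ℕ) : MvPolynomial (Fin p × Fin k) ℂ) := by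
    refine Matrix.ext fun i j => ?_
    rw [Inst.matrix, Matrix.of_apply, Matrix.diagonal_apply]
    by_cases hij : i = j
    · subst hij
      rw [if_pos rfl, (hok i i.2).1.1, Tof_zero, dirE_empty_col, mul_one]
    · have hj : (j : ℕ) ≠ i := fun e => hij (Fin.ext e.symm)
      rcases (hok i i.2).2 j j.2 with h | h
      · exact absurd h hj
      · rw [if_neg hij, h, Nat.cast_zero, zero_mul]
  rw [hM, Matrix.det_diagonal]
  refine Finset.prod_ne_zero_iff.mpr fun i _ => ?_
  exact_mod_cast (hok i i.2).1.2

/-- The specialisation homomorphism of one component: `X_{(a, c)} ↦ X^{ρ a}`, other variables constant. -/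
noncomputable def φc (ĉ : Fin k) (r : Fin p → ℕ) :
    MvPolynomial (Fin p × Fin k) ℂ →+* (MvPolynomial (Fin p × Fin k) ℂ)[X] :=
  (MvPolynomial.aeval (R := ℂ) fun q : Fin p × Fin k =>
    if q.2 = ĉ then (X : (MvPolynomial (Fin p × Fin k) ℂ)[X]) ^ r q.1 else C (MvPolynomial.X q)).toRingHom

/-- The specialisation sends the generic table to the height table. -/
theorem φc_genT (ĉ : Fin k) (r : Fin p → ℕ) (a : Fin p) (d : Fin k) :
    φc ĉ r (G p k a d) = heightTable (G p k) ĉ r a d := by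
  simp [φc, G, genT, heightTable, setCol]

/-- The specialisation on a row. -/
theorem φc_dirE (ĉ : Fin k) (r : Fin p → ℕ) (S : Finset (Fin p)) (w : Fin p → ℕ) (T : Finset (Fin k)) :
    φc ĉ r (dirE (G p k) S w T) = dirE (heightTable (G p k) ĉ r) S w T := by
  rw [map_dirE]
  exact dirE_congr S w fun a d _ => φc_genT ĉ r a d

/-- The specialisation on a matrix entry. -/
theorem φc_entry (ĉ : Fin k) (r : Fin p → ℕ) (s : ℕ) (S : Finset (Fin p)) (w : Fin p → ℕ) (T : Finset (Fin k)) :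
    φc ĉ r (((s : ℕ) : MvPolynomial (Fin p × Fin k) ℂ) * dirE (G p k) S w T) =
      ((s : ℕ) : (MvPolynomial (Fin p × Fin k) ℂ)[X]) * dirE (heightTable (G p k) ĉ r) S w T := by
  rw [← φc_dirE ĉ r S w T]
  rw [map_mul]
  rw [map_natCast]

/-- **Soundness of a split level.**  If the leading instance has nonzero generic determinant, so has the instance:
the matrix is block diagonal by components (labels), each block is specialised by its own height homomorphism, the
specialised matrix satisfies the two-sided scaling identity with leading matrix = the leading instance
(`det_ne_zero_of_potentials`), and `Matrix.BlockTriangular.det` passes between the whole and the blocks. -/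
theorem splitStep_sound (c : ℕ) (lab : List ℕ) (ords : List (List ℕ)) (α β : List ℕ) (I : Inst)
    (hsup : supOK p n I = true) (hok : (splitStep k n c lab ords α β I).1 = true)
    (hdet : ((splitStep k n c lab ords α β I).2.matrix p k n (G p k)).det ≠ 0) :
    (I.matrix p k n (G p k)).det ≠ 0 := by
  classical
  obtain ⟨hc, hE⟩ := splitStep_ok c lab ords α β I hok
  set ĉ : Fin k := ⟨c, hc⟩ with hĉ
  set R₀ := MvPolynomial (Fin p × Fin k) ℂ with hR₀
  let b : Fin n → ℕ := fun i => lab.getD i 0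
  let r : ℕ → Fin p → ℕ := fun l => rOf p (ords.getD l [])
  set M := I.matrix p k n (G p k) with hMdef
  -- block structure
  have hzero : ∀ i j : Fin n, b i ≠ b j → M i j = 0 := by
    intro i j hij
    rcases hE i j with h | h
    · rw [hMdef, Inst.matrix, Matrix.of_apply, h, Nat.cast_zero, zero_mul]
    · exact absurd h.1 hij
  have hBT : M.BlockTriangular b := fun i j hij => hzero i j (ne_of_gt hij)
  -- the specialised matrix
  set MX : Matrix (Fin n) (Fin n) R₀[X] := Matrix.of fun i j => φc ĉ (r (b i)) (M i j) with hMX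
  have hBTX : MX.BlockTriangular b := fun i j hij => by
    rw [hMX, Matrix.of_apply, hzero i j (ne_of_gt hij), map_zero]
  -- the scaling identity
  set N : Matrix (Fin n) (Fin n) R₀[X] := Matrix.of fun i j =>
    nEnt (G p k) ĉ (r (b i)) (α.getD i 0) (β.getD j 0) (I.supL i) (I.entL i j) (I.colN j) with hN
  have hscale : ∀ i j : Fin n, (X : R₀[X]) ^ (α.getD i 0) * MX i j = N i j * (X : R₀[X]) ^ (β.getD j 0) := by
    intro i j
    rw [hMX, Matrix.of_apply, hN, Matrix.of_apply]
    rcases hE i j with h | h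
    · rw [hMdef, Inst.matrix, Matrix.of_apply, h, Nat.cast_zero, zero_mul, map_zero, mul_zero, nEnt, if_pos h, zero_mul]
    · rw [hMdef, Inst.matrix, Matrix.of_apply, φc_entry]
      exact entry_scale (G p k) hc _ _ _ (supOK_spec hsup i).1 _ _ h.2
  have hN0 : (Matrix.of fun i j => (N i j).eval 0) = (splitStep k n c lab ords α β I).2.matrix p k n (G p k) := by
    refine Matrix.ext fun i j => ?_
    rw [Matrix.of_apply, hN, Matrix.of_apply, Inst.matrix, Matrix.of_apply, splitStep_entL, splitStep_colN,
      splitStep_supL]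
    rcases hE i j with h | h
    · have h2 : (newEnt c (ords.getD (lab.getD i 0) []) (α.getD i 0) (β.getD j 0) (I.supL i) (I.entL i j)
          (I.colN j)).2 = kill (I.entL i j) := by unfold newEnt; rw [if_pos h]
      rw [nEnt, if_pos h, eval_zero, h2]
      simp [kill]
    · obtain ⟨hl, hps, hnd⟩ := supOK_spec hsup i
      exact entry_eval_zero (G p k) hc _ _ _ hl hps hnd _ _ h.2
  have hMXdet : MX.det ≠ 0 :=
    ChowBenchmarkSplitLeading.det_ne_zero_of_potentials MX N _ _ hscale (by rw [hN0]; exact hdet)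
  -- blocks
  have hblk : ∀ l, (MX.toSquareBlock b l) = (φc ĉ (r l)).mapMatrix (M.toSquareBlock b l) := by
    intro l
    refine Matrix.ext fun x y => ?_
    rw [Matrix.toSquareBlock_def, Matrix.of_apply, RingHom.mapMatrix_apply, Matrix.map_apply, Matrix.toSquareBlock_def,
      Matrix.of_apply, hMX]
    show (φc ĉ (r (b x.1))) (M x.1 y.1) = (φc ĉ (r l)) (M x.1 y.1)
    rw [show b x.1 = l from x.2]
  have hdetX := hBTX.det
  have hblocks : ∀ l ∈ Finset.univ.image b, (M.toSquareBlock b l).det ≠ 0 := by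
    intro l hl h0
    apply hMXdet
    rw [hdetX]
    apply Finset.prod_eq_zero hl
    rw [hblk l, ← RingHom.map_det, h0, map_zero]
  rw [hBT.det]
  exact Finset.prod_ne_zero_iff.mpr hblocks

/-- **SOUNDNESS OF THE CHECKER**: a certified instance has nonzero determinant at the generic table. -/
theorem det_genTable_ne_zero_of_check :
    ∀ (ls : List Level) (I : Inst), supOK p n I = true → check k n ls I = true → (I.matrix p k n (G p k)).det ≠ 0
  | [], I, _, h => leaf_sound I h
  | Level.perm σ :: ls, I, hs, h => by
    rw [check, Bool.and_eq_true] at h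
    exact permStep_sound σ I h.1 (det_genTable_ne_zero_of_check ls _ hs h.2)
  | Level.split c lab ords α β :: ls, I, hs, h => by
    rw [check, Bool.and_eq_true] at h
    exact splitStep_sound c lab ords α β I hs h.1 (det_genTable_ne_zero_of_check ls _ hs h.2)

/-- **SOUNDNESS, existence form**: some complex table makes a certified instance nonsingular. -/
theorem exists_table_of_check (ls : List Level) (I : Inst) (hs : supOK p n I = true) (h : check k n ls I = true) :
    ∃ P : Fin p → Fin k → ℂ, (I.matrix p k n P).det ≠ 0 := by
  classical
  have hD := det_genTable_ne_zero_of_check ls I hs h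
  by_contra hall
  push Not at hall
  apply hD
  apply MvPolynomial.funext
  intro x
  rw [map_zero, RingHom.map_det]
  have e : (MvPolynomial.eval x).mapMatrix (I.matrix p k n (G p k)) = I.matrix p k n (fun a c => x (a, c)) := by
    refine Matrix.ext fun i j => ?_
    rw [RingHom.mapMatrix_apply, Matrix.map_apply, Inst.matrix, Inst.matrix, Matrix.of_apply, Matrix.of_apply, map_mul,
      map_natCast, map_dirE]
    congr 1
    exact dirE_congr _ _ fun a d _ => by simp [G, genT]
  rw [e]
  exact hall _

end Sound


section RootMatrix

/-- A nonzero code below `2^k` has a nonempty column. -/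
theorem Tof_nonempty {m : ℕ} (hm : m ≠ 0) (hmk : m < 2 ^ k) : (Tof k m).Nonempty := by
  by_contra h
  rw [Finset.not_nonempty_iff_eq_empty] at h
  apply hm
  apply Nat.eq_of_testBit_eq
  intro i
  rw [Nat.zero_testBit]
  by_cases hi : i < k
  · have : (⟨i, hi⟩ : Fin k) ∉ Tof k m := by rw [h]; exact Finset.notMem_empty _
    rw [mem_Tof] at this
    simpa using this
  · exact Nat.testBit_lt_two_pow (lt_of_lt_of_le hmk (Nat.pow_le_pow_right (by norm_num) (not_lt.mp hi)))

/-- With all weights `1` the weight function is `1` on the support. -/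
theorem wOf_one {ps : List ℕ} (hlen : ps.length ≤ 2) (s : ℕ) {a : Fin p} (ha : a ∈ Sof p ps) : wOf ps (s, 1, 1) a = 1 := by
  have ha' := val_mem_of_mem_Sof ha
  rcases ps with _ | ⟨x, _ | ⟨y, _ | ⟨z, t⟩⟩⟩
  · simp at ha'
  · simp only [List.mem_singleton] at ha'
    simp [wOf, ha']
  · simp only [List.mem_cons, List.not_mem_nil, or_false] at ha'
    rcases ha' with h | h
    · simp [wOf, h]
    · by_cases hx : (a : ℕ) = x
      · simp [wOf, hx]
      · simp [wOf, h]
  · simp at hlen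

/-- **The matrix of the root instance is the weight-one (segment-moment) matrix** «rows × first `n` codes». -/
theorem rootInst_matrix {R : Type*} [CommRing R] (rows : List (List ℕ)) (hrows : ∀ i < n, (rows.getD i []).length ≤ 2)
    (hn : n ≤ 2 ^ k) (P : Fin p → Fin k → R) :
    (rootInst rows n).matrix p k n P =
      Matrix.of fun i j : Fin n => dirE P (Sof p (rows.getD i [])) (fun _ => 1) (Tof k j) := by
  refine Matrix.ext fun i j => ?_
  rw [Inst.matrix, Matrix.of_apply, Matrix.of_apply, rootInst_entL, rootInst_colN, rootInst_supL]
  by_cases h : ((rows.getD i []).isEmpty && !decide ((j : ℕ) = 0)) = true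
  · rw [if_pos h, Nat.cast_zero, zero_mul]
    simp only [Bool.and_eq_true, List.isEmpty_iff, Bool.not_eq_true', decide_eq_false_iff_not] at h
    rw [h.1, Sof_nil, dirE_empty_row]
    exact Tof_nonempty h.2 (lt_of_lt_of_le j.2 hn)
  · rw [if_neg h, Nat.cast_one, one_mul]
    exact dirE_congr_weights P _ _ fun a ha => wOf_one (hrows i i.2) _ ha

/-- `supOK` from its specification. -/
theorem supOK_of_spec {I : Inst} (h : ∀ i < n, (I.supL i).length ≤ 2 ∧ (∀ x ∈ I.supL i, x < p) ∧ (I.supL i).Nodup) :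
    supOK p n I = true := by
  unfold supOK
  rw [List.all_eq_true]
  intro i hi
  rw [List.mem_range] at hi
  obtain ⟨h1, h2, h3⟩ := h i hi
  simp only [Bool.and_eq_true, decide_eq_true_eq, List.all_eq_true]
  exact ⟨⟨h1, fun x hx => h2 x hx⟩, h3⟩

/-- **Root soundness**: a certified row family (lists of ≤ 2 distinct points `< p`) is nonsingular on the first `n ≤ 2^k` codes at
some complex table. -/
theorem exists_table_of_check_root (rows : List (List ℕ))
    (hrows : ∀ i < n, (rows.getD i []).length ≤ 2 ∧ (∀ x ∈ rows.getD i [], x < p) ∧ (rows.getD i []).Nodup)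
    (hn : n ≤ 2 ^ k) (ls : List Level) (h : check k n ls (rootInst rows n) = true) :
    ∃ P : Fin p → Fin k → ℂ, (Matrix.of fun i j : Fin n => dirE P (Sof p (rows.getD i [])) (fun _ => 1) (Tof k j)).det ≠ 0 := by
  obtain ⟨P, hP⟩ := exists_table_of_check ls (rootInst rows n) (supOK_of_spec hrows) h
  refine ⟨P, ?_⟩
  rwa [rootInst_matrix rows (fun i hi => (hrows i hi).1) hn] at hP

end RootMatrix

/-! ## 8. Row families given as finsets: encoding and the arrow to HAAR instances -/

section Nodes

open Summit.ValiantsHypothesis.ValiantsHypothesis.Theorems.BarrierLever.MoorePeel (benchCols)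

/-- Encoding a family of finsets of points as support lists (sorted point indices). -/
def encode {h n : ℕ} (S : Fin n → Finset (Fin h)) : List (List ℕ) :=
  List.ofFn fun i : Fin n => ((S i).sort (· ≤ ·)).map Fin.val

/-- Reading the encoding back. -/
theorem encode_getD {h n : ℕ} (S : Fin n → Finset (Fin h)) (i : Fin n) :
    (encode S).getD i [] = ((S i).sort (· ≤ ·)).map Fin.val := by
  unfold encode; rw [getD_ofFn _ _ i.2]

/-- Decoding the encoding gives the finset back. -/
theorem Sof_encode {h n : ℕ} (S : Fin n → Finset (Fin h)) (i : Fin n) : Sof h ((encode S).getD i []) = S i := by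
  ext a
  rw [encode_getD]
  simp only [Sof, Finset.mem_filter, Finset.mem_univ, true_and, List.mem_map, Finset.mem_sort]
  constructor
  · rintro ⟨b, hb, hba⟩
    rwa [← Fin.val_injective hba]
  · intro ha; exact ⟨a, ha, rfl⟩

/-- The encoding of a family of sets of size `≤ 2` is well formed. -/
theorem encode_spec {h n : ℕ} (S : Fin n → Finset (Fin h)) (hS : ∀ i, (S i).card ≤ 2) :
    ∀ i < n, ((encode S).getD i []).length ≤ 2 ∧ (∀ x ∈ (encode S).getD i [], x < h) ∧ ((encode S).getD i []).Nodup := by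
  intro i hi
  rw [encode_getD S ⟨i, hi⟩]
  refine ⟨?_, ?_, ?_⟩
  · rw [List.length_map, Finset.length_sort]; exact hS _
  · intro x hx
    obtain ⟨a, _, rfl⟩ := List.mem_map.mp hx
    exact a.2
  · exact (Finset.sort_nodup _ _).map Fin.val_injective

/-- **ARROW: a split certificate for a row family makes it Haar-nonsingular** — the conclusion of `Stmt.haar` for that family. -/
theorem haar_of_check {h n : ℕ} (S : Fin n → Finset (Fin h)) (hS : ∀ i, (S i).card ≤ 2) (hn : n ≤ 2 ^ h)
    (ls : List Level) (hc : check h n ls (rootInst (encode S) n) = true) :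
    ∃ P : Fin h → Fin h → ℂ,
      (Matrix.of fun i j : Fin n =>
        ∑ g : (↥(benchCols h n j) → ↥(S i)), (∏ c : ↥(benchCols h n j), P (g c) c) *
          ∏ a : ↥(S i), ((Finset.univ.filter fun c : ↥(benchCols h n j) => g c = a).card.factorial : ℂ)).det ≠ 0 := by
  obtain ⟨P, hP⟩ := exists_table_of_check_root (p := h) (k := h) (encode S) (encode_spec S hS) hn ls hc
  refine ⟨P, ?_⟩
  have e : (Matrix.of fun i j : Fin n => dirE P (Sof h ((encode S).getD i [])) (fun _ => 1) (Tof h j)) =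
      Matrix.of fun i j : Fin n =>
        ∑ g : (↥(benchCols h n j) → ↥(S i)), (∏ c : ↥(benchCols h n j), P (g c) c) *
          ∏ a : ↥(S i), ((Finset.univ.filter fun c : ↥(benchCols h n j) => g c = a).card.factorial : ℂ) := by
    refine Matrix.ext fun i j => ?_
    rw [Matrix.of_apply, Matrix.of_apply, Sof_encode, dirE_one]
    rfl
  rwa [e] at hP

end Nodes

end Cert

end Summit.ValiantsHypothesis.ValiantsHypothesis.Theorems.BarrierLever.ChowBenchmarkSplit
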